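import Literature.AlgebraicGeometry.Limits.LocalizationSmoothSpread
import Literature.AlgebraicGeometry.RelativeSpec.GeometricQuotientGroupLaw
import Mathlib.RingTheory.Localization.LocalizationLocalization
import HarnessLib

/-!
# Limits of schemes, RELATIVE over `P`: smooth over `P ×_A Spec A_S` ⇒ smooth over `P ×_A D(s)` for some stage `s`
# ([EGA IV₄] 17.7.8 (ii); [Stacks] Tags 0C0C, 01Z3; [Görtz–Wedhorn I] Thm. 10.57 ∕ §(10.13))

Topic `Literature/AlgebraicGeometry/Limits`; namespace `Literature.AlgebraicGeometry.Limits.LocApprox` (continues ★ `LocalizationDiagram`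
`Spec A_S = lim_s D(s)`, ★ `LocalizationProdLimit` `P ×_A Spec A_S = lim_s P ×_A D(s)` (Stacks 01ZC), ★ `LocalizationSmoothSpread` = the
ABSOLUTE case `P = Spec A`).  THEOREMS ONLY (no definition, no named fact, no `instance`, no notation, no `sorry`).  Cell `hodgecm-mathlib`
(D-0151), FLOOR 0, P6 «MOD programme», SPREAD door of `stub_RGD` (LEAD M-17m), organ (α) SP1 «ABELIAN-SCHEME SPREAD OVER A LocApprox STAGE»,
FILE **(b) «RELATIVE SMOOTH SPREAD»** of A-p06 (g31)՚s census `F0/P6/A-p06/g31/CENSUS-SP1-AbelianSchemeSpreadStage.A-p06g31.md` §3 (b)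
(LEAD F0P6-plan (g2) cut 20:42:56Z: (a) A-p06, (b) A-p14, (c) B-p18, (d) A-p01, (e) A-p06).  `--supports stmt-HodgeConjecture-24832`,
count-neutral: HC_CM is proved only modulo the 2 remaining named inputs (hLiu418 24832, h413 24833) until rung 0 closes; nothing here is about HC.

SETTING (★ currency): `A` a ring, `S ⊆ A` a submonoid, `B = A_S`; `P → Spec A` quasi-compact; the STAGES `P ⊗ D(t) = P ×_A Spec A[1∕t]`
(`(baseDiagram S).obj t`, `t : Idx S`), the GENERIC FIBRE `P ⊗ specOver A B = P ×_A Spec A_S` with cone legs `P ◁ (baseCone S B).π.app t`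
and transitions `P ◁ (baseDiagram S).map ρ` (`ρ : s ⟶ t`, i.e. `D(s) ⊆ D(t)`); a `P ⊗ D(t)`-scheme `Y` (any `Y : Over (P ⊗ D(t)).left`,
quasi-compact and locally of finite presentation over `P ⊗ D(t)`), its GENERIC FIBRE `Y ×_{P ⊗ D(t)} (P ⊗ Spec A_S) → P ⊗ Spec A_S`
(`pullback.snd Y.hom (P ◁ (baseCone S B).π.app t).left`) and its RESTRICTIONS `Y ×_{P ⊗ D(t)} (P ⊗ D(s)) → P ⊗ D(s)`
(`pullback.snd Y.hom (P ◁ (baseDiagram S).map ρ).left`).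

THE MATHEMATICS ([EGAIV4] 17.7.8 (ii) ∕ [StacksProject] Tag 0C0C «if `X → Y = lim Y_i` of finite presentation is smooth then some `X_i → Y_i`
is smooth», here for the cofiltered system of the `P ⊗ D(s)`; [GortzWedhorn2020] §(10.13) pp. 261–262, Thm. 10.57 p. 264).  (1) The cone leg
`Spec A_S → D(t) = Spec A[1∕t]` is a LOCALISATION (`A_S = (A[1∕t])_S`, Mathlib `IsLocalization.isLocalization_of_submonoid_le`), hence flat and
surjective on stalks (★ `flat_specMap_algebraMap`, ★ `surjectiveOnStalks_specMap_algebraMap`); so is its base change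
`π_t : P ⊗ Spec A_S → P ⊗ D(t)` (★ `isPullback_whiskerLeft_left`; both properties are stable under base change).  (2) Hence every point of
`Y` in the image of the generic fibre lies in the SMOOTH LOCUS `W ⊆ Y` of `Y → P ⊗ D(t)` (★ `Motives.mem_smoothLocus_of_isPullback`: the stalk
maps agree up to isomorphism).  (3) Read `Y` as an `A`-scheme `Y′ := (Y → P ⊗ D(t) → Spec A)`; the generic fibre of `Y` maps to `Y′ ×_A Spec A_S`
over `Y` (a comparison morphism — in fact an isomorphism, not needed), and `Y′ ×_A Spec A_S = lim_s Y′ ×_A D(s)` is a limit of quasi-compact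
schemes with affine transitions (★ `isLimitProdCone`), so the open `W`, whose preimage in the limit is everything, has full preimage in some
stage `Y′ ×_A D(s)`, `s ≤ t` (Mathlib `exists_map_eq_top`, Stacks 01Z3): `Y|_{D(s)} ⊆ W`.  (4) The restriction `Y ×_{P ⊗ D(t)} (P ⊗ D(s))` IS the
open `Y|_{D(s)}` of `Y`, so `Y ×_{P⊗D(t)} (P⊗D(s)) → Y → P ⊗ D(t)` is smooth, and since `P ⊗ D(s) → P ⊗ D(t)` is an open immersion,
`Y ×_{P⊗D(t)} (P⊗D(s)) → P ⊗ D(s)` is smooth (Mathlib: `Smooth` respects open immersions on the right).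

* §1 `isScalarTower_toLoc`, `isLocalization_map_loc` (`A_S` is the localisation of `A[1∕t]`), **`flat_baseCone_π_app_left`**,
  **`surjectiveOnStalks_baseCone_π_app_left`**, `flat_whiskerLeft_baseCone_π_app_left`, `surjectiveOnStalks_whiskerLeft_baseCone_π_app_left`;
* §2 **`range_fst_subset_smoothLocus_of_smooth_snd`** (step (2)), `smooth_snd_of_range_fst_subset_smoothLocus` (step (4) for any open immersion
  of the base), `range_fst_whiskerLeft_map_subset` (the restriction lands in `Y|_{D(s)}`);
* §3 `exists_comp_fst_eq_fst` (the comparison morphism of step (3)), `quasiCompact_tensorObj_baseDiagram_hom`, the TOTAL-SPACE LOCUS LEMMA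
  **`exists_stage_range_fst_subset`** (any open `U ⊆ Y` containing the generic fibre contains a restriction `Y ×_{P⊗D(t)} (P ⊗ D(s))` — reusable
  for every fibrewise property with an open locus on `Y`), HEAD **`exists_stage_smooth`** (memo §3 (b) verbatim).

## References
* [EGAIV4] A. Grothendieck, J. Dieudonné, EGA IV₄ (Publ. Math. IHÉS 32, 1967), Prop. 17.7.8 (ii).
* [StacksProject] The Stacks Project, Tag 0C0C (smoothness and limits), Tag 01Z3 (opens in limits of schemes), Tag 01ZC.
* [GortzWedhorn2020] U. Görtz, T. Wedhorn, *Algebraic Geometry I*, 2nd ed. (2020), §(10.13) pp. 261–262, Thm. 10.57 p. 264, Prop. 4.16 p. 101.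
-/

set_option autoImplicit false

noncomputable section

universe u

open CategoryTheory CategoryTheory.Limits AlgebraicGeometry TopologicalSpace MonoidalCategory CartesianMonoidalCategory
open Opposite

namespace Literature.AlgebraicGeometry.Limits

namespace LocApprox

open Literature.AlgebraicGeometry.Motives (SchemeOver specOver mem_smoothLocus_of_isPullback)
open Literature.AlgebraicGeometry.RelativeSpec.ActionOver.IsGeometricQuotient (isPullback_whiskerLeft_left)

set_option backward.isDefEq.respectTransparency false

variable {A : Type u} [CommRing A] (S : Submonoid A) (B : Type u) [CommRing B] [Algebra A B] [IsLocalization S B]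

/-! ## §1 The cone leg `Spec A_S → D(t)` and its base change `P ⊗ Spec A_S → P ⊗ D(t)` are flat and surjective on stalks -/

/-- `A → A[1∕t] → A_S` is a scalar tower for the algebra structure `toLoc S B t : A[1∕t] → A_S`. [cite: GortzWedhorn2020, §(10.13) (pp. 261–262)] -/
theorem isScalarTower_toLoc (t : Idx S) :
    letI : Algebra (loc S t) B := (toLoc S B t).toAlgebra
    IsScalarTower A (loc S t) B :=
  letI : Algebra (loc S t) B := (toLoc S B t).toAlgebra
  IsScalarTower.of_algebraMap_eq' (toLoc_comp_algebraMap S B t).symm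

/-- **`A_S` is the localisation of `A[1∕t]` at (the image of) `S`** (`t ∈ S`; Mathlib `IsLocalization.isLocalization_of_submonoid_le`).
[cite: GortzWedhorn2020, §(10.13) (pp. 261–262)] -/
theorem isLocalization_map_loc (t : Idx S) :
    letI : Algebra (loc S t) B := (toLoc S B t).toAlgebra
    IsLocalization (S.map (algebraMap A (loc S t))) B := by
  letI : Algebra (loc S t) B := (toLoc S B t).toAlgebra
  haveI := isScalarTower_toLoc S B t
  exact IsLocalization.isLocalization_of_submonoid_le (loc S t) B (Submonoid.powers t.val) S
    ((Submonoid.powers_le).mpr t.mem)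

/-- **The cone leg `Spec A_S → D(t)` is flat** (a localisation). [cite: GortzWedhorn2020, §(10.13) (pp. 261–262)] -/
theorem flat_baseCone_π_app_left (t : Idx S) : Flat ((baseCone S B).π.app t).left := by
  letI : Algebra (loc S t) B := (toLoc S B t).toAlgebra
  haveI := isLocalization_map_loc S B t
  rw [baseCone_π_app_left']
  exact flat_specMap_algebraMap (S.map (algebraMap A (loc S t))) B

/-- **The cone leg `Spec A_S → D(t)` is surjective on stalks** (a localisation). [cite: GortzWedhorn2020, §(10.13) (pp. 261–262)] -/
theorem surjectiveOnStalks_baseCone_π_app_left (t : Idx S) : SurjectiveOnStalks ((baseCone S B).π.app t).left := by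
  letI : Algebra (loc S t) B := (toLoc S B t).toAlgebra
  haveI := isLocalization_map_loc S B t
  rw [baseCone_π_app_left']
  exact surjectiveOnStalks_specMap_algebraMap (S.map (algebraMap A (loc S t))) B

variable (P : SchemeOver A)

/-- **`π_t : P ⊗ Spec A_S → P ⊗ D(t)` is flat**: a base change of the cone leg (★ `isPullback_whiskerLeft_left`).
[cite: GortzWedhorn2020, Prop. 4.16 (p. 101)] -/
theorem flat_whiskerLeft_baseCone_π_app_left (t : Idx S) : Flat (P ◁ (baseCone S B).π.app t).left :=
  haveI := flat_baseCone_π_app_left S B t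
  MorphismProperty.of_isPullback (isPullback_whiskerLeft_left ((baseCone S B).π.app t) P) inferInstance

/-- **`π_t : P ⊗ Spec A_S → P ⊗ D(t)` is surjective on stalks**: a base change of the cone leg. [cite: GortzWedhorn2020, Prop. 4.16 (p. 101)] -/
theorem surjectiveOnStalks_whiskerLeft_baseCone_π_app_left (t : Idx S) : SurjectiveOnStalks (P ◁ (baseCone S B).π.app t).left :=
  haveI := surjectiveOnStalks_baseCone_π_app_left S B t
  MorphismProperty.of_isPullback (isPullback_whiskerLeft_left ((baseCone S B).π.app t) P) inferInstance

/-! ## §2 The smooth locus of `Y → P ⊗ D(t)` contains the image of the generic fibre; smoothness over an open of the base -/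

variable {S B}

/-- **If the generic fibre `Y ×_{P⊗D(t)} (P ⊗ Spec A_S) → P ⊗ Spec A_S` is smooth, the smooth locus of `Y → P ⊗ D(t)` contains the image of the
generic fibre** (`π_t` is flat and surjective on stalks, so the stalk maps agree: ★ `Motives.mem_smoothLocus_of_isPullback`).
[cite: StacksProject, Tag 0C0C] [cite: EGAIV4, Prop. 17.7.8 (ii)] -/
theorem range_fst_subset_smoothLocus_of_smooth_snd {t : Idx S} (Y : Over (P ⊗ (baseDiagram S).obj t).left)
    [LocallyOfFinitePresentation Y.hom] (h : Smooth (pullback.snd Y.hom (P ◁ (baseCone S B).π.app t).left)) :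
    Set.range (pullback.fst Y.hom (P ◁ (baseCone S B).π.app t).left) ⊆ (Y.hom.smoothLocus : Set Y.left) := by
  haveI := flat_whiskerLeft_baseCone_π_app_left S B P t
  haveI := surjectiveOnStalks_whiskerLeft_baseCone_π_app_left S B P t
  haveI := h
  rintro _ ⟨x, rfl⟩
  refine mem_smoothLocus_of_isPullback (IsPullback.of_hasPullback Y.hom (P ◁ (baseCone S B).π.app t).left) ?_
  rw [Scheme.Hom.smoothLocus_eq_top]
  trivial

/-- **Smoothness over an open of the base, read off on the smooth locus**: for an open immersion `g : Q → P ⊗ D(t)`, if `Y ×_{P⊗D(t)} Q → Y` lands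
in the smooth locus of `Y → P ⊗ D(t)` then `Y ×_{P⊗D(t)} Q → Q` is smooth (`Y × Q → Y → P⊗D(t)` is smooth and equals `Y × Q → Q ↪ P ⊗ D(t)`;
`Smooth` respects open immersions on the right). [cite: StacksProject, Tag 0C0C] -/
theorem smooth_snd_of_range_fst_subset_smoothLocus {X Q : Scheme.{u}} {Y : Over X} [LocallyOfFinitePresentation Y.hom] (g : Q ⟶ X)
    [IsOpenImmersion g] (hW : Set.range (pullback.fst Y.hom g) ⊆ (Y.hom.smoothLocus : Set Y.left)) : Smooth (pullback.snd Y.hom g) := by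
  have h1 : Smooth (pullback.fst Y.hom g ≫ Y.hom) := by
    rw [← Scheme.Hom.smoothLocus_eq_top_iff, ← Scheme.Hom.preimage_smoothLocus_eq, preimage_eq_top_iff_range_subset]
    exact hW
  rw [pullback.condition] at h1
  exact MorphismProperty.of_postcomp (W := @Smooth) (W' := @IsOpenImmersion) (pullback.snd Y.hom g) g inferInstance h1

/-- The restriction `Y ×_{P⊗D(t)} (P ⊗ D(s)) → Y` lands in `Y|_{D(s)}`: its image lies in the preimage of `D(s)` under `Y → P ⊗ D(t) → Spec A`, i.e. in
the image of `Y′ ×_A D(s) → Y` for the `A`-scheme `Y′ := (Y → Spec A)`. [cite: GortzWedhorn2020, §(10.13) (pp. 261–262)] -/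
theorem range_fst_whiskerLeft_map_subset {P : SchemeOver A} {s t : Idx S} (ρ : s ⟶ t) (Y : Over (P ⊗ (baseDiagram S).obj t).left) :
    Set.range (pullback.fst Y.hom (P ◁ (baseDiagram S).map ρ).left) ⊆
      Set.range (pullback.fst (Y.hom ≫ (P ⊗ (baseDiagram S).obj t).hom) ((baseDiagram S).obj s).hom) := by
  rw [Scheme.Pullback.range_fst, Scheme.Pullback.range_fst]
  rintro y ⟨z, hz⟩
  refine ⟨pullback.snd P.hom ((baseDiagram S).obj s).hom z, ?_⟩
  change ((baseDiagram S).obj s).hom (pullback.snd P.hom ((baseDiagram S).obj s).hom z) = (P ⊗ (baseDiagram S).obj t).hom (Y.hom y)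
  rw [← hz]
  change (pullback.snd P.hom ((baseDiagram S).obj s).hom ≫ ((baseDiagram S).obj s).hom) z =
    ((P ◁ (baseDiagram S).map ρ).left ≫ (P ⊗ (baseDiagram S).obj t).hom) z
  rw [Over.w (P ◁ (baseDiagram S).map ρ), Over.tensorObj_hom, pullback.condition]
  rfl

/-! ## §3 The limit argument on `Y` read as an `A`-scheme, and the head -/

/-- **The comparison morphism**: the generic fibre `Y ×_{P⊗D(t)} (P ⊗ Spec A_S)` receives `Y′ ×_A Spec A_S` over `Y` (`Y′ := (Y → P ⊗ D(t) → Spec A)`),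
so the image of `Y′ ×_A Spec A_S → Y` lies in the image of the generic fibre. [cite: GortzWedhorn2020, Prop. 4.16 (p. 101)] -/
theorem exists_comp_fst_eq_fst {t : Idx S} (Y : Over (P ⊗ (baseDiagram S).obj t).left) :
    ∃ c : pullback (Y.hom ≫ (P ⊗ (baseDiagram S).obj t).hom) (specOver A B).hom ⟶ pullback Y.hom (P ◁ (baseCone S B).π.app t).left,
      c ≫ pullback.fst Y.hom (P ◁ (baseCone S B).π.app t).left = pullback.fst (Y.hom ≫ (P ⊗ (baseDiagram S).obj t).hom) (specOver A B).hom := by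
  -- the map to `P ⊗ Spec A_S = P ×_A Spec A_S`
  obtain ⟨m, hm1, hm2⟩ : ∃ m : pullback (Y.hom ≫ (P ⊗ (baseDiagram S).obj t).hom) (specOver A B).hom ⟶ (P ⊗ specOver A B).left,
      m ≫ pullback.fst P.hom (specOver A B).hom =
          pullback.fst (Y.hom ≫ (P ⊗ (baseDiagram S).obj t).hom) (specOver A B).hom ≫ Y.hom ≫ pullback.fst P.hom ((baseDiagram S).obj t).hom ∧
        m ≫ pullback.snd P.hom (specOver A B).hom = pullback.snd (Y.hom ≫ (P ⊗ (baseDiagram S).obj t).hom) (specOver A B).hom :=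
    ⟨pullback.lift (pullback.fst _ _ ≫ Y.hom ≫ pullback.fst P.hom ((baseDiagram S).obj t).hom) (pullback.snd _ _) (by
        rw [Category.assoc, Category.assoc, ← Over.tensorObj_hom, pullback.condition]),
      pullback.lift_fst _ _ _, pullback.lift_snd _ _ _⟩
  have hm : pullback.fst (Y.hom ≫ (P ⊗ (baseDiagram S).obj t).hom) (specOver A B).hom ≫ Y.hom = m ≫ (P ◁ (baseCone S B).π.app t).left := by
    apply pullback.hom_ext
    · rw [Category.assoc, Category.assoc, Over.whiskerLeft_left_fst]
      exact hm1.symm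
    · haveI : Mono ((baseDiagram S).obj t).hom := inferInstance
      have hm2' : m ≫ pullback.snd P.hom (specOver A B).hom ≫ ((baseCone S B).π.app t).left =
          pullback.snd (Y.hom ≫ (P ⊗ (baseDiagram S).obj t).hom) (specOver A B).hom ≫ ((baseCone S B).π.app t).left := by
        rw [← Category.assoc, hm2]
      rw [Category.assoc, Category.assoc, Over.whiskerLeft_left_snd]
      erw [hm2']
      rw [← cancel_mono ((baseDiagram S).obj t).hom, Category.assoc, Category.assoc, Category.assoc, Over.w ((baseCone S B).π.app t),
        ← pullback.condition (f := P.hom) (g := ((baseDiagram S).obj t).hom), ← Over.tensorObj_hom, pullback.condition]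
      rfl
  exact ⟨pullback.lift _ m hm, pullback.lift_fst _ _ _⟩

/-- `P ⊗ D(t) → Spec A` is quasi-compact when `P → Spec A` is. [cite: GortzWedhorn2020, §(10.13) (pp. 261–262)] -/
theorem quasiCompact_tensorObj_baseDiagram_hom [QuasiCompact P.hom] (t : Idx S) : QuasiCompact (P ⊗ (baseDiagram S).obj t).hom := by
  rw [Over.tensorObj_hom]
  infer_instance

/-- **TOTAL-SPACE LOCUS LEMMA — an open of `Y` containing the generic fibre contains a restriction `Y ×_{P⊗D(t)} (P ⊗ D(s))`**
(Stacks 01Z3 on `Y′ ×_A Spec A_S = lim_s Y′ ×_A D(s)`, `Y′ := (Y → P ⊗ D(t) → Spec A)`): for `P → Spec A` and `Y → P ⊗ D(t)` quasi-compact and an open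
`U ⊆ Y` containing the image of the generic fibre `Y ×_{P⊗D(t)} (P ⊗ Spec A_S) → Y`, some stage `s ≤ t` has the image of
`Y ×_{P⊗D(t)} (P ⊗ D(s)) → Y` inside `U` (the open `Y|_{D(s)}` already does).  The smooth spread below, and the sibling spreads of fibrewise
properties read on an open locus of `Y`, are this lemma + «the locus is open» + «the locus contains the generic fibre».
[cite: StacksProject, Tag 01Z3] [cite: GortzWedhorn2020, §(10.13) (pp. 261–262)] -/
theorem exists_stage_range_fst_subset [QuasiCompact P.hom] {t : Idx S} (Y : Over (P ⊗ (baseDiagram S).obj t).left) [QuasiCompact Y.hom]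
    (U : Y.left.Opens) (hU : Set.range (pullback.fst Y.hom (P ◁ (baseCone S B).π.app t).left) ⊆ (U : Set Y.left)) :
    ∃ (s : Idx S) (ρ : s ⟶ t), Set.range (pullback.fst Y.hom (P ◁ (baseDiagram S).map ρ).left) ⊆ (U : Set Y.left) := by
  haveI := quasiCompact_tensorObj_baseDiagram_hom P t
  -- `Y` as an `A`-scheme
  let Y' : SchemeOver A := Over.mk (Y.hom ≫ (P ⊗ (baseDiagram S).obj t).hom)
  haveI : QuasiCompact Y'.hom := inferInstanceAs (QuasiCompact (Y.hom ≫ (P ⊗ (baseDiagram S).obj t).hom))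
  -- the open `U|` of the stage `t` of `Y′ ×_A Spec A_S = lim_s Y′ ×_A D(s)`, whose preimage in the limit is everything
  let U' : ((prodDiagram S Y').obj t).Opens := (pullback.fst Y'.hom ((baseDiagram S).obj t).hom) ⁻¹ᵁ U
  have hU' : (prodCone S B Y').π.app t ⁻¹ᵁ U' = ⊤ := by
    change ((prodCone S B Y').π.app t ≫ pullback.fst _ _) ⁻¹ᵁ U = ⊤
    rw [prodCone_π_app_fst, preimage_eq_top_iff_range_subset]
    obtain ⟨c, hc⟩ := exists_comp_fst_eq_fst (B := B) P Y
    change Set.range (pullback.fst (Y.hom ≫ (P ⊗ (baseDiagram S).obj t).hom) (specOver A B).hom) ⊆ _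
    rw [← hc]
    rintro _ ⟨x, rfl⟩
    exact hU ⟨c x, (Scheme.Hom.comp_apply _ _ x).symm⟩
  obtain ⟨s, ρ, hs⟩ := exists_map_eq_top (prodDiagram S Y') (prodCone S B Y') (isLimitProdCone S B Y') U' hU'
  refine ⟨s, ρ, subset_trans (range_fst_whiskerLeft_map_subset ρ Y) ?_⟩
  rw [← preimage_eq_top_iff_range_subset]
  change (pullback.fst Y'.hom ((baseDiagram S).obj s).hom) ⁻¹ᵁ U = ⊤
  rw [← prodDiagram_map_fst S Y' ρ]
  exact hs

/-- **RELATIVE SMOOTH SPREAD OVER A LocApprox STAGE** ([EGAIV4] 17.7.8 (ii) ∕ [StacksProject] 0C0C, relative over `P`): let `P → Spec A` be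
quasi-compact, `Y → P ⊗ D(t)` quasi-compact and locally of finite presentation, and suppose the generic fibre
`Y ×_{P⊗D(t)} (P ⊗ Spec A_S) → P ⊗ Spec A_S` is smooth.  Then for some stage `s ≤ t` the restriction `Y ×_{P⊗D(t)} (P ⊗ D(s)) → P ⊗ D(s)` is
smooth. (= A-p06 (g31) SP1 census §3 (b) verbatim.) [cite: EGAIV4, Prop. 17.7.8 (ii)] [cite: StacksProject, Tag 0C0C] [cite: GortzWedhorn2020, Thm. 10.57 (p. 264)] -/
theorem exists_stage_smooth [QuasiCompact P.hom] {t : Idx S} (Y : Over (P ⊗ (baseDiagram S).obj t).left) [QuasiCompact Y.hom]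
    [LocallyOfFinitePresentation Y.hom] (h : Smooth (pullback.snd Y.hom (P ◁ (baseCone S B).π.app t).left)) :
    ∃ (s : Idx S) (ρ : s ⟶ t), Smooth (pullback.snd Y.hom (P ◁ (baseDiagram S).map ρ).left) := by
  obtain ⟨s, ρ, hs⟩ := exists_stage_range_fst_subset P Y Y.hom.smoothLocus (range_fst_subset_smoothLocus_of_smooth_snd P Y h)
  haveI : IsOpenImmersion (P ◁ (baseDiagram S).map ρ).left := isOpenImmersion_prodDiagram_map S P ρ
  exact ⟨s, ρ, smooth_snd_of_range_fst_subset_smoothLocus _ hs⟩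

end LocApprox

end Literature.AlgebraicGeometry.Limits

end
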